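import Literature.MathematicalPhysics.QuantumFieldTheory.Balaban1983to89.B12Ineq544Constant
import Literature.MathematicalPhysics.QuantumFieldTheory.Balaban1983to89.B12BetaAsPrinted

/-!
# `Balaban1983to89.B12Carve26Sect5BetaHyp` — [Balaban1987RG1] pp. 297–301 (Sect. 5, part 2: the representation (5.36)–(5.38)
# of the vacuum-polarization kernel, THE β-FUNCTION (5.39)–(5.42), the quadratic form (5.43) with (5.44), and the closing
# remarks p. 298; pp. 299–301 = the reference list): P6 CARVING-FAN BLOCK 26 — census of the block against the tree (NO
# residual printed statement), and ONE hypothesis bundle `Hyp` of the block's printed statements BY NAME on the kernel carrier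
# of record, keyed to the consumer (`stmt-QuantumFields-20543`, K2⁷ `EndpointGivenB…`: what these pages print about β is
# delivered as the flow letter `FlowStep.BetaUpperH`; what they do NOT print — the sign — is said)

statement-level skeleton of published theorems with citation tags; proofs where landed; nothing here is a claim about the
Yang–Mills mass gap

T. Bałaban, *Renormalization group approach to lattice gauge field theories. I. Generation of effective actions in a small
field approximation and a coupling constant renormalization in four dimensions*, Commun. Math. Phys. **109** (1987) 249–301,
doi:10.1007/bf01215223 `[Balaban1987RG1]` (cell paper "B12" = «[I]»; journal page = PDF page + 248).  STATUS: published,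
refereed.  PDF held: `paper:balaban1987-cmp109-rg-i-small-field`; pp. 296–301 [PDF 48–53] read by this seat on the text layer
(`p0048.txt` … `p0053.txt`, locators «`p00NN.txt:Ln`») AND AS IMAGES (renders `run/shared/lean/pub/pub-balaban/b2b-balaban-ref1/
pages/1987-cmp109-rg-I-small-field/…-p049-x2.png`, `-p050-x2.png`, 2026-08-28).  d = 4 (p. 259, Theorem 2 «Let d = 4»; the
index type `Fin 4` below, as in `B12BetaAsPrinted`).

CITATION HEADER (lean-in-tree rule).  Cell `lit-balaban` (HOME `run/shared/lean/pub/lit-balaban/`), P6 CARVING FAN (D-0154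
(3b)), block 26 of `carve/BLOCKS-21-30.md` (lead g30, 2026-08-28T05:30Z; claimed by seat `carve-01` g6 under RULING #8,
`carve/STATUS.md` 08:01:46Z): «[B12] Sect. 5 part 2: the β-functions (5.36)–(5.44) + β-function properties pp. 298–301 (row
B12.§5beta ABSENT — residuals expected here); 6 SKELETON rows (proved-existing 4, proved 2); KEY stmt-QuantumFields-20543,
also-feeds 20544, 20541».  Filed `--supports stmt-QuantumFields-20543`.  RULES (`carve/CARVE-RULES.md` §2): IN TREE = CITE,
NEVER RESTATE; residual printed statements in hypothesis form; ONE bundle `Hyp`; no `instance`, no `notation`, 0 `sorry`;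
standing-smallness binders displayed (RULING #9; none occurs on these pages).

## WHAT THE BLOCK'S PAGES PRINT AND WHERE THE TREE HOLDS IT (cite table — every SKELETON row of block 26 is IN TREE; nothing in
## this table is restated below)
* p. 296 l. −2 – p. 297 l. 1 and **(5.36)** (`p0049.txt:L2–L3`) «We have discussed already the consequences of the symmetries (5.32).
  They imply that all the coefficients β_μν for μ ≠ ν are equal. Denoting the common value of 2^{d−2}β_μν by β, we get
  f_μν(z) = β(δ_μν Σ_κ (z_κ⁻¹ − 1)(z_κ − 1) − (z_μ⁻¹ − 1)(z_ν − 1)) + … . (5.36) This is the desired representation of the functions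
  f_μν(z).» — row B12.Eq5.36: `B12Rep537.crossQ` ∕ `wilsonQ` (the marginal kernel WITH BODY, `genFun_wilsonQ` its symbol), the
  jet algebra `B12Sec5Algebra.eq536_11` ∕ `eq536_12` (PROVED), and the CONTENT of (5.36)∕(5.37) for a kernel — «Π̃ − βQ̃_μν is of
  third order at p = 0» — as the hypothesis shape `B12Rep537.TaylorData3 β μ ν Π` (its docstring: «the OUTPUT of the symmetry
  analysis (5.12)–(5.36) … displayed here as a hypothesis») — IN THE BUNDLE (`Hyp.t536`); «all the coefficients β_μν for μ ≠ ν
  are equal»: `B12Beta.secondMoment_pair_indep` (from the covariance (1.21)) and `Hyp.beta_indep` below.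
* **(5.37)–(5.38)** p. 297 (`p0049.txt:L5–L10`) «Using the relations (5.17) and substituting z_μ = e^{ip_μ}, we obtain finally
  Π_μν(p) = β(δ_μνΔ(p) − ∂̄_μ(p)∂_ν(p)) + Π′_μν(p). (5.37) The function Π′_μν(p) has all the symmetries of the function Π_μν(p)
  and it can be written in the form of a third order polynomial in the derivatives ∂̄(p), ∂(p), (5.38)» — row B12.Eq5.37-5.38:
  PROVED for every exponentially decaying kernel with the Taylor data, `B12Rep537.rep538` ∕ `rep538_of_decay510` (backward-
  difference words, remainder coefficients `B12Rep537.rem538` = the Gawȩdzki–Kupiainen potentials) and `rep537_genFun` (symbol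
  side); AS PRINTED (mixed words ∂̄∕∂, `B12BetaAsPrinted.diffWord`) it is the member `c537` of `B12BetaAsPrinted.Conclusions` for
  the polarization of the run's 𝐄^{(j+1)}; the sentence «has all the symmetries» is a LOCATED IMPRECISION for the split with the
  literal `wilsonQ μ ν` (true for the transposed form): `B12WardLeadingForm.not_wardB_wilsonQ` ∕ `wardB_wilsonQ_transpose` ∕
  `taylorData3_wilsonQ_transpose` (every use on pp. 297–298 is insensitive) — cited, not typed (as in `B12BetaAsPrinted`).
* p. 297 ll. 11–12 «The coefficients Π′ can be extended to analytic functions of ζ = p + iq on the polystrip ⨉_μ{|q_μ| < δ₁}.» —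
  PROVED: `B12Rep537Momentum.analyticOnNhd_coeff538` ∕ `norm_coeff538_le` ∕ `eq537` ∕ `piT_sub_lead` (the coefficient kernels decay,
  hence their transforms are holomorphic on the polystrip `B12Momentum511.PolyStrip d δ₁`), `B12Rep537.rep537_genFun`.
* **(5.39)–(5.42)** p. 297 (`p0049.txt:L14–L23`) «It remains to calculate the coefficient β, i.e., to express it in terms of the
  tensor Π. We have β = 2^{d−2}(−g_μν(1) + 2a_{μν,μ} − 2a_{μν,ν} + 4b_{μν,μν}) (5.39) for μ ≠ ν … (5.40) … (5.41) and
  β = −(∂²∕∂p₁∂p₂ Π₁₂)(0) = −(∂²∕∂p_μ∂p_ν Π_μν)(0) = Σ_x Π_μν(x)x_μx_ν (5.42) for μ ≠ ν. This is the fundamental equality defining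
  the β-function.» — row B12.Eq5.39-5.42: `B12Sec5Algebra.eq536_12`, `psi541` (PROVED jet algebra); (5.42): `B12Beta.secondMoment`
  (definition with body, = (1.22) p. 264), `B12Rep537.beta_eq_542` (PROVED: forced by the Taylor data — `Hyp.beta_eq_542`),
  `B12Momentum511.beta_eq_neg_pderiv_pderiv` ∕ `secondMoment_eq_neg_pderiv_pderiv` (the two printed equalities of (5.42)),
  `B12BetaAsPrinted.Definitions.d122` (as printed, on the coupling domain), `B12BetaHolo.toBeta542Source`, `B12BetaSmooth.beta_eq_tsum`.
* **(5.43)** p. 297 (`p0049.txt:L24–L31`) «Let us finish now the analysis of the previous section. The first term on the right-hand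
  side of (4.34), after all the changes and resummations, and using (5.37), (5.38), can be written as Σ Π_μν(x − y) tr δB_μ(x)B_ν(y)
  = β½ Σ tr(∂δB)_μν(x)(∂B)_μν(x) + Σ[Π′_{μν,κλρ}(x − y) tr(∂_κ∂_λ∂_ρδB_μ)(x)B_ν(y) + Π′_{μν,κ,λρ}(x − y) tr(∂_λ∂_ρδB_μ)(x)(∂_κB_ν)(y)
  + …]. (5.43)» — row B12.Eq5.43-5.44: `B12Form543.spair` ∕ `form` ∕ `form543_of_rep` ∕ `form543_of_taylorData3` ∕
  `form543_of_symmetries`, `B12Pairing543`, `B12Pairing543Backward` (PROVED, incl. the orientation audit `fsq_ne_pairing_printed`),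
  `B12Covariance54.form543_of_invariance`.
* **(5.44)** p. 297 (`p0049.txt:L32–L35`) «The analyticity properties mentioned after (5.38) imply the corresponding exponential
  decay properties of the functions in the above formula. More exactly, we have |Π′_{μν,κλρ}(x − y)| ≦ O(1)E₀ exp(½δ₁|x − y|)
  ⟦sic: −½δ₁⟧. (5.44)» — `B12Ineq544Constant.ineq544_printed` ∕ `expBound_rem538` ∕ `ineq544_betaPrime` (PROVED from (5.10)),
  member `c537` of `B12BetaAsPrinted.Conclusions` (as printed) — IN THE BUNDLE for the tree's remainder coefficients (`Hyp.r544`),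
  and derived from (5.10) + `t536` (`Hyp.r544_of_decay510`); row B12.Eq5.42's summability `B12Sec2to5.majorant_summable`,
  `betaPrime510`.
* p. 298 ¶1 (`p0050.txt:L2–L12`) «In the third order terms in (5.43) we can always shift the derivatives onto the other function, so we
  can write them in the form in which δB is differentiated once, and B twice. The bound (5.44), and the bounds (4.14), (4.15) for
  derivatives of δB, B imply that all these third order terms in (5.43) are irrelevant. Defining the function β_j as equal to the
  coefficient β in (5.43), we see that the first expression there is cancelled by the first expression in (4.42). The second term on
  the right-hand side of (4.34) is equal to (4.44), and is cancelled by this expression. The third term is equal to 0. In both cases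
  we have used the fact that the first and second order derivatives of the function Π′_μν(p) vanish at p = 0, so we have to
  calculate the corresponding expressions in (4.34) for the first term on the right-hand side of (5.37). These calculations are the
  same as in (4.43), (4.45).» — row B12.Txt@298: PROVED — `B12Form543.spair_third_order_shift` ∕ `spair_delta_kernel_right` ∕
  `form543_remainder_shift` (the shift), `B12Ineq544Constant.thirdOrder543_le` ∕ `thirdOrder543_rem538_le` ∕ `norm_spair_le`
  (irrelevance), `B12Marginal444.marginal_eq_firstVar` ∕ `block2_of_moments443` and `B12Eq442DeltaJ.cancel292_form` ∕
  `cancel292_form_of_symmetries` ∕ `eq442_shift` (the cancellations against (4.42)∕(4.44)), `B12Moments443.moments443` ∕ `moments445` ∕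
  `moments0` ((4.43), (4.45), the vanishing moments of Π′ — `B12Rep537.momentsVanish_sub`), «β_j := the coefficient β» =
  `B12BetaAsPrinted.Conclusions.c537` with `S.β j (…)`.
* p. 298 ¶2 (`p0050.txt:L13–L21`) «Thus we have finished the analysis of the fluctuation field effective action in (2.13) … In the
  next paper we will construct such localizations and prove the bounds. They are used to construct a cluster expansion of the
  integral in (2.13), and to finish the proof of the inductive assumptions for the term E^{(k+1)} defined by (2.13).» — narrative ∕
  forward reference to [Balaban1988RG2Cluster] (cell B13: `B13.Lemma1Printed`–`Lemma3Printed`, `B12NodeKnit`); no statement.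
* p. 298 ¶3 (`p0050.txt:L22–L40`) «Finally, let us make some remarks about the functions E^{(n)} … We can do a similar analysis for the
  higher functions, e.g., for E^{(3)}, E^{(4)}, again using the symmetry properties, especially the Ward-Takahashi identities (4.15).
  We can represent these functions as sums of basic marginal operators with the coefficient β, and higher order operators leading to
  irrelevant terms. … This would give a method alternative to that applied in the previous section. … it seems that the method
  presented in the last section is more clear and simpler. The β-functions are related in the simple way to the tensors Π by the
  formula (5.42). In fact we should write the superscript (j) at the tensor in the formula (5.42) defining the function β_j. We write
  β_j as explicitly dependent on g_{j−1}, although it depends also on all preceding coupling constants. The dependence on g_{j−1} is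
  important and it determines main properties of the renormalization group equations.» — the ALTERNATIVE-METHOD remark is not a
  statement used anywhere (print: «would give», not carried out) — no declaration, none typed; the HISTORY DEPENDENCE of β_j is the
  carrier shape `FlowStep.HBeta` (β_{j+1}(g₀, …, g_j)) used by `B12BetaAsPrinted.Setting.β` ∕ `flowOf` ∕ `sectionHist`,
  `B12CouplingClausesHistory` (`BetaSmoothInLast264` …), `B12Eq213CouplingDependence.historyModuli_of_uniformStep`,
  `B12Eq213HistoryTower*` — IN THE BUNDLE as the type of `Carriers.β`; «determines main properties of the renormalization group
  equations» states no property.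
* pp. 299–301: References 1–72 — no statement.

RESULT OF THE CENSUS.  Every printed statement of pp. 297–301 has a declaration of record; the block's residual is EMPTY and this
file types NO new `…Printed` statement.  On the lead's note «row B12.§5beta ABSENT — residuals expected here»: `HOME/SKELETON.md`
row B12.§5beta is «Sect. 5 β-function properties used by B12 Thm 2 … the POSITIVITY input is NOT printed in the series»; this
seat confirms on the page images that pp. 297–298 print, about β, ONLY its definition (5.39)–(5.42), its role as the coefficient
in (5.37)∕(5.43), and the history-dependence sentence of p. 298 — NO sign, lower bound, monotonicity, continuity in the couplings
or asymptotics (p. 259: Theorem 2 «will be given in a separate paper»; [Balaban1989LargeFieldII] p. 355 «has not been published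
yet») —, and pp. 299–301 are the reference list.  An unprinted property is not Literature (it is the DAG's hypothesis leaf
`Dag.Leaves.betaPositive` ∕ `FlowStep.BetaLowerH 0` ∕ `BetaSignH`); nothing is typed for it here.  What the pages DO yield about
β — uniform boundedness from (5.42) + (5.10) (p. 264 «uniformly bounded»; cell GAPS G-adv2-3) — is delivered below BY NAME as the
consumer's flow letter `FlowStep.BetaUpperH` (`Hyp.betaUpperH`).

## WHAT THIS FILE ADDS
§1 THE BUNDLE on the kernel carrier of record (the complex∕real coefficient side of `B12Rep537` ∕ `B12Beta`, d = 4): `Carriers`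
(plain data) — the polarization kernels Π_{j+1,μν}(g₀, …, g_j; ·) of (1.21)∕(5.1), one per step and coupling history, the
β-functions as a HISTORY-DEPENDENT family `FlowStep.HBeta` (p. 298), the coupling interval γ, the rate δ₁ and the constant of
(5.44); `Hyp X` — the block's two hypothesis-form printed statements BY NAME, at every step j and every history of the printed
coupling domain `B12BetaAsPrinted.histDom γ j`: `t536` = (5.36)–(5.37) with «β_j := the coefficient β» (p. 298) as
`B12Rep537.TaylorData3 (β_{j+1}(h)) μ ν Π_{j+1}(h)`; `r544` = (5.44) for the remainder coefficients of (5.38)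
(`PeriodicGleason.ExpBound (δ₁∕2) C544 (B12Rep537.rem538 …)`).  (5.38) itself, (5.39)–(5.43) and p. 298 are PROVED in tree and
take no slot.
§2 KERNEL-CHECKED BOOKKEEPING out of `Hyp` (no statement asserted): `Hyp.beta_eq_542` — (5.42) «the fundamental equality defining
the β-function» (`B12Rep537.beta_eq_542`); `Hyp.beta_indep` — «all the coefficients β_μν for μ ≠ ν are equal» (pp. 296–297);
`Hyp.rep538` — (5.37)–(5.38) with a (5.44)-type bound at the full rate δ₁ from the block-25 decay (5.10) (`B12Sec2to5.Decay510`,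
`B12Rep537.rep538_of_decay510`); `Hyp.r544_of_decay510` — the slot `r544` FOLLOWS from `t536` + (5.10) («The analyticity
properties … imply … More exactly, we have (5.44)»), so the two slots are consistent; `Hyp.norm_beta_le` — |β_{j+1}(h)| ≤ β′ =
C·Σ_x|x|₁²e^{−δ₁|x|₁} (`B12Ineq544Constant.norm_beta_le_betaPrime`, `B12Sec2to5.betaPrime510`); ★ `Hyp.betaUpperH` ∕
`Hyp.betaLowerH_neg` — the consumer's letters `FlowStep.BetaUpperH β′ γ β` and `FlowStep.BetaLowerH (−β′) γ β` (p. 264 «uniformly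
bounded»), with the docstring recording that `FlowStep.BetaLowerH 0` ∕ `BetaSignH` ∕ `BetaAFH` are NOT obtainable from these pages;
`box_subset_histDom` (the consumer's boxes ]0, γ]^{j+1} lie in the printed coupling domain).  §3 non-vacuity `hyp_zero` (zero
kernels, β ≡ 0) — the slots are jointly satisfiable as typed.

## HONEST SCOPE
Nothing of [I] is proved here beyond bookkeeping between typed shapes and the cited theorems; the Taylor data (5.36) (the
output of pp. 292–296) and (5.44) are HYPOTHESIS slots on abstract kernels (with carriers chosen freely the bundle is inhabited
by zero data, `hyp_zero`; it earns its keep only at Bałaban's polarization kernels, which no module constructs); (5.10) enters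
the bookkeeping as an explicit hypothesis (block 25's statement, `B12Sec2to5.Decay510`); the link to the as-printed record
`B12BetaAsPrinted.Conclusions.c537` (mixed ∂̄∕∂ words) is by citation, not by a kernel theorem; the printed «has all the
symmetries» sentence is cited with its located correction and typed nowhere; NO β-sign, NO Theorem 2, NO continuum statement.
No summit statement is proved by this seat; K2⁷ is NOT discharged; count-neutral; nothing continuum ∕ ℝ⁴ ∕ OS ∕ mass-gap ∕
Clay.  No `sorry`, no `instance`, no `notation`, no attribute manipulation; imports `…B12Ineq544Constant` (hence `…B12Form543`,
`…B12Rep537`, `…B12Sec2to5`, `…GawedzkiKupiainen1985.PeriodicGleason`) and `…B12BetaAsPrinted` (hence `…FlowStep`,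
`…B12CouplingClausesHistory`) only.
-/

noncomputable section

namespace Literature.MathematicalPhysics.QuantumFieldTheory.Balaban1983to89.B12Carve26Sect5BetaHyp

open Literature.MathematicalPhysics.QuantumFieldTheory.GawedzkiKupiainen1985.PeriodicGleason (Pt ExpBound wt wt_pos l1_nonneg
  deltaIter K K_nonneg)
open B12Rep537 (TaylorData3 ofReal wilsonQ rem538 MQ)
open B12Sec2to5 (Decay510 betaPrime510)
open FlowStep (HBeta Box)
open B12BetaAsPrinted (histDom)

/-! ## §1  The bundle: the printed statements of pp. 297–298 as hypotheses, by name, on the kernel carrier -/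

/-- **Carriers of the block-26 bundle** (plain data; d = 4, p. 259 ∕ Theorem 2 «Let d = 4»): `pol j h μ ν` = the real kernel
Π_{j+1,μν}(g₀, …, g_j; x), x ∈ ℤ⁴, of (1.21) p. 264 ∕ (5.1) p. 292 (the vacuum-polarization tensor after the limit T^{(j+1)} ↗ ℤ⁴;
the tree's finite-volume body is `B12PolarizationTensor120.polTensor`, the limit `B12Limit51`, the abstract slot
`B12BetaAsPrinted.Setting.polIV`), one kernel per step j and COUPLING HISTORY `h = (g₀, …, g_j)`; `β : FlowStep.HBeta`, `β j h` =
β_{j+1}(g₀, …, g_j) — p. 298 (`p0050.txt:L36–L39`) «In fact we should write the superscript (j) at the tensor in the formula (5.42)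
defining the function β_j. We write β_j as explicitly dependent on g_{j−1}, although it depends also on all preceding coupling
constants.» (the carrier shape of `B12BetaAsPrinted.Setting.β`); `γ` = the coupling interval (p. 255 «[0, γ], γ > 0», p. 264
«defined on the interval [0, γ]»); `δ₁` = the rate of (5.10) p. 293 ∕ the half-width of the polystrip p. 297; `C544` = the
`O(1)E₀` of (5.44). [cite: Balaban1987RG1, (1.21)–(1.22) p.264, (5.42) p.297, p.298] -/
structure Carriers where
  pol : (j : ℕ) → (Fin (j + 1) → ℝ) → Fin 4 → Fin 4 → Pt 4 → ℝ
  β : HBeta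
  γ : ℝ
  δ₁ : ℝ
  C544 : ℝ

/-- **BLOCK 26 OF [B12] AS ONE HYPOTHESIS BUNDLE** (pp. 297–301 [PDF 49–53]): the printed statements of the block that are
hypothesis-shaped on the kernel carrier, BY NAME, at every step `j` and every coupling history `h` of the printed coupling
domain `B12BetaAsPrinted.histDom X.γ j` (g₀, …, g_{j−1} ∈ ]0, γ], g_j ∈ [0, γ] — p. 263 «g_{j−1} ∈ [0, γ]», p. 264) and every
pair (μ, ν) —
`t536` = **(5.36)–(5.37) p. 297** «f_μν(z) = β(δ_μν Σ_κ (z_κ⁻¹ − 1)(z_κ − 1) − (z_μ⁻¹ − 1)(z_ν − 1)) + … . (5.36) … Π_μν(p) =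
β(δ_μνΔ(p) − ∂̄_μ(p)∂_ν(p)) + Π′_μν(p) (5.37)» with Π′ of third order ((5.38)) and, p. 298 l. 5, «Defining the function β_j as
equal to the coefficient β in (5.43)»: the kernel Π_{j+1,μν}(h; ·) has the second-order Taylor data of β_{j+1}(h)·Q_μν —
`B12Rep537.TaylorData3` (in tree; «displayed here as a hypothesis»);
`r544` = **(5.44) p. 297** «|Π′_{μν,κλρ}(x − y)| ≦ O(1)E₀ exp(½δ₁|x − y|) ⟦sic: −½δ₁⟧» for the remainder coefficient kernels of
(5.38) — the tree's `B12Rep537.rem538` (one per third-order word κλρ) — as `PeriodicGleason.ExpBound (δ₁∕2) C544`.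
(5.38) as a representation, the polystrip analyticity, (5.39)–(5.43) and p. 298 are PROVED in tree (module docstring's
table) and take no slot; (5.10) p. 293 is block 25's statement and enters §2 as an explicit hypothesis.  Hypothesis slot
only; nothing asserted. [cite: Balaban1987RG1, (5.36)–(5.38) p.297, (5.44) p.297, p.298 l.5] -/
structure Hyp (X : Carriers) : Prop where
  /-- (5.36)–(5.37) p. 297 with p. 298 l. 5 — in tree: `B12Rep537.TaylorData3`. -/
  t536 : ∀ (j : ℕ) (h : Fin (j + 1) → ℝ), h ∈ histDom X.γ j → ∀ μ ν : Fin 4,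
    TaylorData3 (X.β j h : ℂ) μ ν (ofReal (X.pol j h μ ν))
  /-- (5.44) p. 297 for the (5.38) remainder coefficients — in tree: `PeriodicGleason.ExpBound`, `B12Rep537.rem538`. -/
  r544 : ∀ (j : ℕ) (h : Fin (j + 1) → ℝ), h ∈ histDom X.γ j → ∀ (μ ν : Fin 4) (μs : Fin 3 → Fin 4),
    ExpBound (X.δ₁ / 2) X.C544 (rem538 (ofReal (X.pol j h μ ν)) (X.β j h : ℂ) μ ν μs)

/-! ## §2  Bookkeeping (kernel-checked uses of the cited declarations; no statement asserted) -/

section Bookkeeping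

variable {X : Carriers}

/-- The consumer's boxes ]0, γ]^{j+1} (`FlowStep.Box`, the domain of the flow letters `FlowStep.BetaUpperH` ∕ `BetaLowerH`) lie
in the printed coupling domain `B12BetaAsPrinted.histDom` (last coupling in [0, γ], the others in ]0, γ]).  Elementary.
[cite: Balaban1987RG1, p.264 (β-clause after (1.22)) with Thm 3 p.264 (bookkeeping)] -/
theorem box_subset_histDom (γ : ℝ) (j : ℕ) : Box γ j ⊆ histDom γ j := by
  intro v hv
  rw [FlowStep.mem_box] at hv
  exact ⟨fun i _ => hv i, (hv (Fin.last j)).1.le, (hv (Fin.last j)).2⟩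

/-- **(5.42) p. 297** «β = −(∂²∕∂p_μ∂p_ν Π_μν)(0) = Σ_x Π_μν(x)x_μx_ν for μ ≠ ν. This is the fundamental equality defining the
β-function.» — out of the slot `t536` by `B12Rep537.beta_eq_542` (the Taylor data FORCE (5.42)): β_{j+1}(h) is the off-diagonal
second moment of Π_{j+1,μν}(h; ·).  Bookkeeping. [cite: Balaban1987RG1, (5.42) p.297 (bookkeeping)] -/
theorem Hyp.beta_eq_542 (hX : Hyp X) {j : ℕ} {h : Fin (j + 1) → ℝ} (hh : h ∈ histDom X.γ j) {μ ν : Fin 4}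
    (hμν : μ ≠ ν) :
    (X.β j h : ℂ) = ∑' x : Pt 4, ofReal (X.pol j h μ ν) x * ((x μ : ℂ) * (x ν : ℂ)) :=
  B12Rep537.beta_eq_542 (hX.t536 j h hh μ ν) hμν

/-- **p. 296 l. −1 – p. 297 l. 1** «all the coefficients β_μν for μ ≠ ν are equal. Denoting the common value of 2^{d−2}β_μν by
β» ∕ (5.42) «for μ ≠ ν»: the defining second moments of any two off-diagonal pairs coincide (both are β_{j+1}(h)).  Bookkeeping.
[cite: Balaban1987RG1, (5.36) p.297 and (5.42) p.297 (bookkeeping)] -/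
theorem Hyp.beta_indep (hX : Hyp X) {j : ℕ} {h : Fin (j + 1) → ℝ} (hh : h ∈ histDom X.γ j) {μ ν μ' ν' : Fin 4}
    (hμν : μ ≠ ν) (hμν' : μ' ≠ ν') :
    ∑' x : Pt 4, ofReal (X.pol j h μ ν) x * ((x μ : ℂ) * (x ν : ℂ)) =
      ∑' x : Pt 4, ofReal (X.pol j h μ' ν') x * ((x μ' : ℂ) * (x ν' : ℂ)) := by
  rw [← hX.beta_eq_542 hh hμν, ← hX.beta_eq_542 hh hμν']

/-- **(5.37)–(5.38) with a (5.44)-type bound, PROVED in tree** (`B12Rep537.rep538_of_decay510` ∕ `rep538`): under the block-25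
decay (5.10) p. 293 «|Π_μν(x)| ≦ O(1)E₀e^{−δ₁|x|}» (`B12Sec2to5.Decay510 Π C δ₁`) the slot `t536` gives, for every (j, h, μ, ν),
Π_{j+1,μν}(h; x) − β_{j+1}(h)·Q_μν(x) = Σ_{κλρ} (Δ*_κΔ*_λΔ*_ρ Π′_{κλρ})(x) (a third-order polynomial in the lattice derivatives) with
every remainder coefficient Π′_{κλρ} = `rem538 … κλρ` exponentially bounded AT THE FULL RATE δ₁, constant K(δ₁, 4)³(C + |β|·MQ(δ₁, 4)).
Bookkeeping. [cite: Balaban1987RG1, (5.37)–(5.38) and (5.44) p.297 (bookkeeping)] -/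
theorem Hyp.rep538 (hX : Hyp X) (hδ : 0 < X.δ₁) {C : ℝ} {j : ℕ} {h : Fin (j + 1) → ℝ} (hh : h ∈ histDom X.γ j)
    {μ ν : Fin 4} (h510 : Decay510 (X.pol j h μ ν) C X.δ₁) :
    (∀ x : Pt 4, ofReal (X.pol j h μ ν) x - (X.β j h : ℂ) * wilsonQ μ ν x =
        ∑ μs : Fin 3 → Fin 4, deltaIter 3 μs (rem538 (ofReal (X.pol j h μ ν)) (X.β j h : ℂ) μ ν μs) x) ∧
      ∀ μs : Fin 3 → Fin 4,
        ExpBound X.δ₁ (K X.δ₁ 4 ^ 3 * (C + ‖(X.β j h : ℂ)‖ * MQ X.δ₁ 4))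
          (rem538 (ofReal (X.pol j h μ ν)) (X.β j h : ℂ) μ ν μs) :=
  B12Rep537.rep538 hδ (B12Rep537.expBound_of_decay510 h510) (hX.t536 j h hh μ ν)

/-- Lowering the rate of an exponential bound (the weight `e^{−a|x|₁}` is antitone in `a`): rate δ₁ gives rate δ₁∕2. [folklore] -/
private theorem expBound_of_rate_le {a a' M : ℝ} (haa : a' ≤ a) {c : Pt 4 → ℂ} (h : ExpBound a M c) :
    ExpBound a' M c := by
  intro n
  have hM : 0 ≤ M := h.nonneg
  refine (h n).trans (mul_le_mul_of_nonneg_left ?_ hM)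
  unfold wt
  exact Real.exp_le_exp.mpr (by nlinarith [l1_nonneg n])

/-- **|β_{j+1}(h)| ≤ β′ uniformly in j and h** — p. 264 «uniformly bounded», from (5.42) + the block-25 decay (5.10) with one
constant C on the printed coupling domain: `‖β‖ ≤ β′ = C·Σ_x|x|₁²e^{−δ₁|x|₁}` (`B12Ineq544Constant.norm_beta_le_betaPrime`,
`B12Sec2to5.betaPrime510`; the undisplayed line of the fidelity ledger, cell GAPS G-adv2-3).  Bookkeeping.
[cite: Balaban1987RG1, (5.42) p.297 with (5.10) p.293 and p.264 («uniformly bounded») (bookkeeping)] -/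
theorem Hyp.norm_beta_le (hX : Hyp X) (hδ : 0 < X.δ₁) {C : ℝ}
    (h510 : ∀ (j : ℕ) (h : Fin (j + 1) → ℝ), h ∈ histDom X.γ j → ∀ μ ν : Fin 4, Decay510 (X.pol j h μ ν) C X.δ₁)
    {j : ℕ} {h : Fin (j + 1) → ℝ} (hh : h ∈ histDom X.γ j) : |X.β j h| ≤ betaPrime510 4 C X.δ₁ := by
  have h01 : (0 : Fin 4) ≠ 1 := by decide
  have := B12Ineq544Constant.norm_beta_le_betaPrime hδ (h510 j h hh 0 1) (hX.t536 j h hh 0 1) h01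
  rwa [Complex.norm_real, Real.norm_eq_abs] at this

/-- **The slot `r544` FOLLOWS from `t536` and (5.10)** — p. 297 «The analyticity properties mentioned after (5.38) imply the
corresponding exponential decay properties of the functions in the above formula. More exactly, we have (5.44)»: with the
block-25 decay the remainder coefficients obey (5.44) at rate δ₁∕2 with the explicit constant K(δ₁, 4)³(C + β′·MQ(δ₁, 4)), so the two
slots of `Hyp` are consistent (the slot keeps print's own constant name `C544`).  Bookkeeping.
[cite: Balaban1987RG1, (5.44) p.297 with (5.10) p.293 (bookkeeping)] -/
theorem Hyp.r544_of_decay510 (hX : Hyp X) (hδ : 0 < X.δ₁) {C : ℝ}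
    (h510 : ∀ (j : ℕ) (h : Fin (j + 1) → ℝ), h ∈ histDom X.γ j → ∀ μ ν : Fin 4, Decay510 (X.pol j h μ ν) C X.δ₁)
    {j : ℕ} {h : Fin (j + 1) → ℝ} (hh : h ∈ histDom X.γ j) (μ ν : Fin 4) (μs : Fin 3 → Fin 4) :
    ExpBound (X.δ₁ / 2) (K X.δ₁ 4 ^ 3 * (C + betaPrime510 4 C X.δ₁ * MQ X.δ₁ 4))
      (rem538 (ofReal (X.pol j h μ ν)) (X.β j h : ℂ) μ ν μs) := by
  have hrep := (hX.rep538 hδ hh (h510 j h hh μ ν)).2 μs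
  have hβ : ‖(X.β j h : ℂ)‖ ≤ betaPrime510 4 C X.δ₁ := by
    rw [Complex.norm_real, Real.norm_eq_abs]; exact hX.norm_beta_le hδ h510 hh
  have hK : 0 ≤ K X.δ₁ 4 ^ 3 := pow_nonneg (K_nonneg hδ 4) 3
  have hMQ : 0 ≤ MQ X.δ₁ 4 := B12Rep537.MQ_nonneg X.δ₁ 4
  refine expBound_of_rate_le (by linarith) (hrep.mono ?_)
  exact mul_le_mul_of_nonneg_left (add_le_add (le_refl C) (mul_le_mul_of_nonneg_right hβ hMQ)) hK

/-- ★ **The consumer's letter: `FlowStep.BetaUpperH`** — p. 264's «uniformly bounded» for the history-dependent β-family on the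
boxes ]0, γ]^{j+1} (which lie in the printed coupling domain, `box_subset_histDom`): β_{j+1}(h) ≤ β′ for every j and every
h ∈ Box γ j.  This is the ONE property of β that pp. 297–298 (with (5.10)) deliver; the SIGN letters `FlowStep.BetaLowerH 0` ∕
`BetaSignH` ∕ `BetaAFH` and Theorem 2 are NOT printed-proved anywhere in the series (module docstring, RESULT OF THE CENSUS) and are
NOT consequences of `Hyp`.  Bookkeeping. [cite: Balaban1987RG1, p.264 («uniformly bounded») with (5.42) p.297 and (5.10) p.293 (bookkeeping)] -/
theorem Hyp.betaUpperH (hX : Hyp X) (hδ : 0 < X.δ₁) {C : ℝ}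
    (h510 : ∀ (j : ℕ) (h : Fin (j + 1) → ℝ), h ∈ histDom X.γ j → ∀ μ ν : Fin 4, Decay510 (X.pol j h μ ν) C X.δ₁) :
    FlowStep.BetaUpperH (betaPrime510 4 C X.δ₁) X.γ X.β := fun j _ hv =>
  (le_abs_self _).trans (hX.norm_beta_le hδ h510 (box_subset_histDom X.γ j hv))

/-- The trivial two-sided companion: `FlowStep.BetaLowerH (−β′) γ β` (|β| ≤ β′ read downward).  NOT the sign: `BetaLowerH 0` is
the unprinted input `Dag.Leaves.betaPositive`.  Bookkeeping. [cite: Balaban1987RG1, p.264 («uniformly bounded») with (5.42) p.297 (bookkeeping)] -/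
theorem Hyp.betaLowerH_neg (hX : Hyp X) (hδ : 0 < X.δ₁) {C : ℝ}
    (h510 : ∀ (j : ℕ) (h : Fin (j + 1) → ℝ), h ∈ histDom X.γ j → ∀ μ ν : Fin 4, Decay510 (X.pol j h μ ν) C X.δ₁) :
    FlowStep.BetaLowerH (-betaPrime510 4 C X.δ₁) X.γ X.β := fun j _ hv =>
  (neg_le_neg (hX.norm_beta_le hδ h510 (box_subset_histDom X.γ j hv))).trans (neg_abs_le _)

end Bookkeeping

/-! ## §3  Non-vacuity: the bundle is inhabited (zero kernels, β ≡ 0) -/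

section Witness

/-- Zero carriers: `pol` ≡ 0, β ≡ 0, γ = δ₁ = 1, C544 = 0. [folklore] -/
def zeroCarriers : Carriers where
  pol := fun _ _ _ _ _ => 0
  β := fun _ _ => 0
  γ := 1
  δ₁ := 1
  C544 := 0

/-- **The block-26 bundle is inhabited**: the zero kernels have the Taylor data of 0·Q_μν, and their (5.38) remainder
coefficients vanish in norm (by `B12Rep537.rep538` at M = 0, β = 0), so both slots hold — a NON-VACUITY INSTANCE of the typed
bundle (consistency of the typing, nothing about gauge theory). [cite: Balaban1987RG1, (5.36)–(5.38) and (5.44) p.297 (non-vacuity instance)] -/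
theorem hyp_zero : Hyp zeroCarriers := by
  have hT : ∀ μ ν : Fin 4, TaylorData3 ((0 : ℝ) : ℂ) μ ν (ofReal fun _ : Pt 4 => (0 : ℝ)) := by
    intro μ ν
    unfold B12Rep537.TaylorData3
    intro γ _
    simp [B12Rep537.ofReal]
  have hE : ∀ μ ν : Fin 4, ExpBound (1 : ℝ) 0 (ofReal fun _ : Pt 4 => (0 : ℝ)) := by
    intro μ ν
    unfold ExpBound
    intro n
    simp [B12Rep537.ofReal]
  refine ⟨fun j h _ μ ν => hT μ ν, fun j h _ μ ν μs => ?_⟩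
  have hrep := (B12Rep537.rep538 (d := 4) one_pos (hE μ ν) (hT μ ν)).2 μs
  have hzero : K (1 : ℝ) 4 ^ 3 * (0 + ‖((0 : ℝ) : ℂ)‖ * MQ 1 4) = 0 := by simp
  rw [hzero] at hrep
  show ExpBound (1 / 2) 0 _
  exact expBound_of_rate_le (by norm_num) hrep

end Witness

end Literature.MathematicalPhysics.QuantumFieldTheory.Balaban1983to89.B12Carve26Sect5BetaHyp

end
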